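import Literature.NumberTheory.GaloisCohomology.Howard2004.Thm161PrintIntendedOfEngineInputs
import Literature.NumberTheory.GaloisCohomology.Howard2004.DVRSettingEngineH159OfUnitsProofs
import Literature.NumberTheory.GaloisCohomology.Howard2004.DVRSettingEngineParityProofs
import Literature.NumberTheory.GaloisCohomology.Howard2004.DVRSettingEngineChebBindersProofs
import Literature.NumberTheory.GaloisCohomology.Howard2004.DVRSettingEngineGDLineAssembly
import Literature.NumberTheory.GaloisCohomology.Howard2004.ResidualEigenlinesProofs
import Literature.NumberTheory.GaloisCohomology.Howard2004.DVRSettingResidualLocalInputsProofs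
import Literature.NumberTheory.GaloisCohomology.Howard2004.DVRSettingDatumDeltaProofs
import Literature.NumberTheory.GaloisCohomology.Howard2004.DVRSettingDatumChiProofs
import Literature.NumberTheory.GaloisCohomology.Howard2004.DVRSettingDatumLettersProofs
import Literature.NumberTheory.GaloisCohomology.Howard2004.DVRSettingEngineRhoProofs
import Literature.NumberTheory.GaloisCohomology.Howard2004.EngineDecompositionsOfSkewPairingFactProofs
import Literature.NumberTheory.GaloisCohomology.Howard2004.ResidualTateDualBijectiveProofs
import Literature.NumberTheory.EllipticCurves.PoitouTateSelmerStructuresConj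
import HarnessLib

/-!
# Howard 2004, Thm. 1.6.1 as intended by its printed proof (F-161′ `thm161_dvrKolyvaginBound_printIntended`)
# from the print leaf C45.1′ (Prop. 1.4.1 / Thm. 1.4.2 as applied) and Poitou–Tate duality — the closing term
# of the cell's ENGINE (theorems only)

Topic `NumberTheory/GaloisCohomology/Howard2004`.  THEOREMS ONLY: no definition, no named fact, no instance, no
notation, no `sorry`.  B. Howard, *The Heegner point Kolyvagin system*, Compositio Math. **140** (2004) 1439–1472 =
arXiv:1202.6340, Thm. 1.6.1 (arXiv Thm. 2.6.1, p. 11 L17–32) with its proof (§1.3 hypotheses H.0–H.5, Prop. 1.1.9,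
Lemma 1.3.3, Prop. 1.4.1 / Thm. 1.4.2, Lemma 1.5.3, Def. 1.5.4, Prop. 1.5.5, Lemma 1.5.7, Prop. 1.5.9, Lemma 1.6.2,
Lemma 1.6.3, Lemma 1.6.4; p. 6 L17 – p. 12 L55).

The cell `pub/bsd-print-x9` (G87 desk) formalised that proof as an ENGINE on `DVRSetting`s: TAME-WLOG and the π-adic
REFINE/COFINAL transports reduce the statement to FULL tame-pinned settings; there Lemma 1.6.4's double induction
(`StubLemmaInductionProofs`) runs on five inputs HLAM, H159, HSMALL, HCHEBI, HCHEBII, all of which are now kernel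
theorems of the tree MODULO (i) the print leaf C45.1′ `prop141_casselsTate_skewPairing_atLevel` (Howard's Prop. 1.4.1 +
Thm. 1.4.2 as applied, after Flach 1990 — a cite-only named fact supplying the levelwise structure decompositions) and
(ii) Poitou–Tate duality for Selmer structures with conjugation-compatible invariants
`poitouTate_selmerStructure_duality_conj K` (Milne ADT I 4.10; a theorem of the tree Summits-side —
`InputsPoitouTateSelmer.poitouTate_selmerStructure_duality_conj_holds` — kept as a binder in Literature).  Chebotarev's density theorem enters by NAME as the kernel
theorem `Automorphic.chebotarev_artinRep_of_galoisSide`.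

* **`DVRSetting.thm161_printIntended_of_prop141`** —
  `prop141_casselsTate_skewPairing_atLevel → (∀ K, poitouTate_selmerStructure_duality_conj K) →
  thm161_dvrKolyvaginBound_printIntended`.

Assembly (per full tame-pinned `S` with H.0–H.5, `(p : R) ≠ 0`, `p ∤ #𝓞_K^×`, `𝓛_s ⊂ 𝓛`, `κ_1 ≠ 0`), by name:
`hdec := hasLevelDecompositions_of_prop141` (x9-p1 LEAD g9) · `ρ± := exists_eigenLengths` (x10b-p1-w8 g11) ·
`hdis := engine_hdis` (x9-p1-w3 g15, R3) · `hGD := engine_gd_dich_of_eigenlines` (x10b-p1-w8 g11, R7 = Lemma 1.5.3 at the residual level from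
R3–R5: x9-p1-w3 g15, x10b-p1-w6 g9, x10b-p2 LEAD g15) fed with the six eigenline letters `residual_eigenline_letters` (R6, x10b-p1-w5 g9) · `hpar := engine_hpar_of_letters` (x10b-p1-w7 g10) ·
`H159 := engine_h159_of_units` (x9-p1-w4 g17 / x10b-p1-w7 g10) with the datum letters `datum_hI/hφ/hφI/hφΛ` (x10b-p1-w5 g9 /
x9-p1-w4 g17), `datum_hδ_of_hχ` (x9-p1-w4 g17) ∘ `datum_hχ` (x10b-p1-w5 g9) · `HCHEB := engine_hchebI/engine_hchebII`
(x10b-p1-w6 g9) · closing wrapper `thm161_printIntended_of_prop141_h159_hcheb` (bsd-line-x10b-p1 LEAD g13 over x10b-p1-w2 g16's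
`thm161_of_prop141_h159_hcheb`).

Cell `pub/bsd-print-x9`, print leaf G87 (`stub_h161` of stmt-BirchSwinnertonDyer-22642); seat `bsd-line-x10b-p1-w2` g17
(«Thm161OfEngineBricks»).  HONEST FRAMING: this proves F-161′ CONDITIONALLY on the cite-only print fact C45.1′ and on
Poitou–Tate duality (a binder here); the verbatim-as-worded F-161 `thm161_dvrKolyvaginBound` (no guards) is NOT proved;
no summit statement is proved; the Birch–Swinnerton-Dyer conjecture is NOT proved by any of this.
References: [Howard2004HeegnerKolyvagin] Thm. 1.6.1 and §1.1–§1.6; [MilneADT2006] I Thm. 4.10; [Flach1990] (via C45.1′);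
[TateGCFT1967] §2.4 (Chebotarev).
-/

set_option autoImplicit false

noncomputable section

open Function NumberField IsDedekindDomain Field
open scoped NumberField ContRepresentation Classical

namespace Literature.NumberTheory.GaloisCohomology.Howard2004

open Literature.NumberTheory.GaloisRepresentations
open Literature.NumberTheory.GaloisRepresentations.DiscreteGaloisModule
open Literature.NumberTheory.GaloisRepresentations.galoisCohomology
open Literature.NumberTheory.EllipticCurves

namespace DVRSetting

/-- **Howard 2004, Thm. 1.6.1 as intended by its printed proof (F-161′), from the print leaf C45.1′ (Prop. 1.4.1 /
Thm. 1.4.2 as applied) and Poitou–Tate duality for Selmer structures.**  For every `DVRSetting` with H.0–H.5,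
`(p : R) ≠ 0`, `p ∤ #𝓞_K^×`, `𝓛_s ⊂ 𝓛` for `s ≫ 0` and a Kolyvagin system `κ` with `κ_1 ≠ 0`: `𝓗` is free of rank one
over `R` and `length_R(M^{(i)}) ≤ length_R(𝓗^{(i)}/R κ_1^{(i)})` for every `i` (`S.Conclusion`).  Proof = the cell's
engine, every residual/Galois letter discharged BY NAME (module docstring); Chebotarev by
`Automorphic.chebotarev_artinRep_of_galoisSide`.  CONDITIONAL on the two displayed hypotheses; the as-worded F-161 is
not proved; BSD is not proved by this.
[cite: Howard2004HeegnerKolyvagin, Thm. 1.6.1 (arXiv:1202.6340 Thm. 2.6.1, p. 11 L17–32; proof p. 11 L33 – p. 12 L55), Prop. 1.1.9, Lemma 1.3.3, Prop. 1.4.1, Thm. 1.4.2, Lemma 1.5.3, Def. 1.5.4, Prop. 1.5.5, Lemma 1.5.7, Prop. 1.5.9, Lemma 1.6.2, Lemma 1.6.3, Lemma 1.6.4]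
[cite: MilneADT2006, Ch. I, Thm. 4.10] -/
theorem thm161_printIntended_of_prop141 (h141 : prop141_casselsTate_skewPairing_atLevel)
    (hPT : ∀ (K : Type) [Field K] [NumberField K], poitouTate_selmerStructure_duality_conj K) :
    thm161_dvrKolyvaginBound_printIntended := by
  refine thm161_printIntended_of_prop141_h159_hcheb h141 ?_
  intro p _ K _ _ R _ _ _ _ N _ _ _ _ Rk _ _ _ _ _ _ _ _ Nbar _ _ _ _ Nq _ _ _ _ _ _ _ S _ hy _ _ _ _ hp0 hu hL _
  letI : ∀ k, Module R (galoisCohomology (S.T.ρ k) 1) :=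
    fun k => galoisCohomology.moduleH1 (S.T.ρ k) (S.T.hlin k)
  letI : ∀ (k : ℕ) (v : Place K), Module R (galoisCohomology ((S.T.ρ k).toLocal v) 1) :=
    fun k v => galoisCohomology.moduleH1 ((S.T.ρ k).toLocal v) ((S.T.hlin k).restrictField (Place.Completion v))
  haveI : Finite Nbar := S.finite_residual hy
  haveI : ∀ k, Finite (N k) := fun k => S.finite_level hy k
  have hdec : S.HasLevelDecompositions hy := S.hasLevelDecompositions_of_prop141 h141 hy
  -- Prop. 1.1.9 at the residual level (R3): `F̄_k(v) ∩ H¹_tr(K_v, T̄) = 0` at every engine prime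
  have HDIS : ∀ (k : ℕ) (v : HeightOneSpectrum (𝓞 K)) (hv : v ∈ S.enginePrimes k),
      Disjoint (((hy.h1 k).1.propagateStructure (S.t k).cond) (Sum.inr v))
        ((transverseStructure p S.ρbar S.jbar) (Sum.inr v)) :=
    fun k v hv => S.engine_hdis hy hu k v hv
  -- Lemma 1.5.3 at the residual level (R7): (GD-line)± and (DICH)± at every engine prime off `n`
  have hGD := fun (k : ℕ) (n : Finset (HeightOneSpectrum (𝓞 K))) (hn : ↑n ⊆ S.enginePrimes k) =>
    S.engine_gd_dich_of_eigenlines hy k hu (hPT K) hn (S.residual_eigenline_letters hy k hu).1 (S.residual_eigenline_letters hy k hu).2.1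
      (S.residual_eigenline_letters hy k hu).2.2.1 (S.residual_eigenline_letters hy k hu).2.2.2.1 (S.residual_eigenline_letters hy k hu).2.2.2.2.1
      (S.residual_eigenline_letters hy k hu).2.2.2.2.2
  refine ⟨?_, ?_⟩
  · -- H159 = Prop. 1.5.9 in the engine shape (Lemma 1.5.3's parity `hpar` from the eigen-lengths and R7)
    obtain ⟨ρp, ρm, hρp, hρm⟩ := S.exists_eigenLengths hy hdec
    exact S.engine_h159_of_units hy hdec hu (poitouTate_selmerStructure_duality_of_conj (hPT K)) S.datum_hI (S.datum_hφ hy) S.datum_hφI (S.datum_hφΛ hy)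
      (S.datum_hδ_of_hχ hy (S.datum_hχ hy))
      (S.engine_hpar_of_letters hy ρp ρm hρp hρm HDIS hGD)
  · -- HCHEB = Lemma 1.6.2 (Chebotarev) + Lemma 1.5.3, Cases i / ii of Lemma 1.6.4
    intro ρp ρm hρp hρm
    exact ⟨S.engine_hchebI hy Automorphic.chebotarev_artinRep_of_galoisSide hp0 hL ρp ρm
        (fun k n hn => (hρp k n hn).trans rfl) (fun k n hn => (hρm k n hn).trans rfl) (fun k v hv => HDIS k v hv)
        (fun k n hn => (hGD k n hn).1) (fun k n hn => (hGD k n hn).2.2.1) (fun k n hn => (hGD k n hn).2.1)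
        (fun k n hn => (hGD k n hn).2.2.2),
      S.engine_hchebII hy Automorphic.chebotarev_artinRep_of_galoisSide hp0 hL ρp ρm
        (fun k n hn => (hρp k n hn).trans rfl) (fun k n hn => (hρm k n hn).trans rfl) (fun k v hv => HDIS k v hv)
        (fun k n hn => (hGD k n hn).1) (fun k n hn => (hGD k n hn).2.2.1) (fun k n hn => (hGD k n hn).2.1)
        (fun k n hn => (hGD k n hn).2.2.2)⟩

end DVRSetting

end Literature.NumberTheory.GaloisCohomology.Howard2004

end
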